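import Literature.Geometry.Kaehler.ComplexTorusAnalyticIteratedTranslatesClass
import Literature.Geometry.Kaehler.ComplexTorusThetaDivisorMultiplicities
import Literature.Geometry.Kaehler.ComplexTorusThetaDivisorSmoothLocus
import Literature.Geometry.Kaehler.ComplexTorusAnalyticCycleDegreePositive
import Literature.Geometry.Kaehler.ComplexTorusWedgePowNonvanishing
import HarnessLib

/-!
# On an abelian variety, general iterated hypersurface translates meet a subvariety with multiplicity one:
# `[Y ∩ ⋂_j (D_j − t_j)] = [Y] ∧ [D₀] ∧ ⋯ ∧ [D_{k−1}]` for almost every `(t_j) ∈ X^k`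

Layer `Literature/Geometry/Kaehler`; lane `lit-hodgefound`, seat p07, programme «INTERSECTION NUMBERS ARE
POINT COUNTS», file 6: the positivity hypothesis (P) of `ComplexTorusAnalyticIteratedTranslatesClass`
(an auxiliary hypersurface `H` with `[W] · [H]^r ≠ 0` for every `r`-dimensional `W`) is discharged on
ABELIAN VARIETIES by a REDUCED THETA DIVISOR: for a polarisation `L = L(H, χ)` of `X` a general member
`Θ = (θ)` of `|L|` is reduced ([Lange2023AbelianVarietiesComplex, Prop. 2.1.6], the tree's
`exists_thetaFunction_reduced_divisor`), so its class is `[Θ] = c₁(L) = ofRealForm(−H)`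
(`chainCycleClass_divisorChain`, `divisorChain_eq_ofSet_of_isMinimalDefiningOn`), and `∫_W c₁(L)^r > 0` for
every closed analytic `W` of pure dimension `r` (`IsRiemannForm.poincarePairing_wedgePow_analyticCycleClass_ne_zero`,
[deJong1993AmpleLineBundles, VII Thm. 4.3.1]).

Contents (theorems only; no definitions, no named facts; `e` a positively oriented real basis,
`orientationSign Φ e = 1`):

* §1 **`IsAbelianVariety.exists_hasPureDim_analyticCycleClass_eq_ofRealForm`** — an abelian variety carries a
  (reduced theta) hypersurface `Θ` with `[Θ]_e = ofRealForm(−η)` for a Riemann form `η`;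
  **`IsAbelianVariety.exists_hasPureDim_forall_wedge_wedgePow_ne_zero`** — hence a hypersurface `Θ` with
  `[W]_e ∧ [Θ]_e^{∧r} ≠ 0` for EVERY closed analytic `W` of pure dimension `r` (all `r`), and
  `IsAbelianVariety.exists_hasPureDim_forall_inter_iInter_translate_nonempty` — every `r` translates of `Θ`
  meet every such `W` (the hypothesis (P) of file 5, orientation-free);
* §2 `IsAbelianVariety.ae_smul_wedge_wedgeFamily_eq_setCycleClass` (any basis `e`, with the factor
  `sign(e)^k`) and **`IsAbelianVariety.ae_wedge_wedgeFamily_eq_setCycleClass`** — THE THEOREM: on an abelian variety, for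
  `Y` closed analytic of pure dimension `r + k` and closed analytic hypersurfaces `D₀, …, D_{k−1}`, for almost
  every `τ ∈ X^k`: `Y ∩ ⋂_j (D_j − τ_j)` is empty or of pure dimension `r` and
  `[Y]_e ∧ [D₀]_e ∧ ⋯ ∧ [D_{k−1}]_e = [Y ∩ ⋂_j (D_j − τ_j)]_e` ([Lange2023AbelianVarietiesComplex, §4.6.2:
  "`(V · W)` is the degree of the `0`-cycle `V · t_x^* W`", iterated as in the proof of Lemma 4.6.9;
  [Fulton1998, Example 11.4.5]; Kleiman's transversality theorem (b)); `IsAbelianVariety.exists_…`;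
* §3 **`IsAbelianVariety.ae_wedgeFamily_eq_setCycleClass_iInter_translate`** — the case `Y = X`:
  `[D₀]_e ∧ ⋯ ∧ [D_{k−1}]_e = [⋂_j (D_j − τ_j)]_e` for almost every `τ` (the wedge monomials of hypersurface
  classes, e.g. the powers of a polarisation, are classes of reduced complete intersections of general translates);
* §4 **`IsAbelianVariety.exists_forall_hasPureDim_analyticCycleClass_eq_wedgePow`** — every power
  `c₁(L)^{∧k}` (`k ≤ dim X`) of a polarisation is the class `[Z]_e` of a REDUCED closed analytic `Z` of pure
  dimension `dim X − k` ([Lange2023AbelianVarietiesComplex, §7.3.1 p. 336], with multiplicity one);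
* §5 `IsAbelianVariety.wedge_wedgeFamily_eq_zero_or_exists_eq_analyticCycleClass`,
  **`IsAbelianVariety.wedgeFamily_eq_zero_or_exists_eq_analyticCycleClass`** — `[Y] ∧ [D₀] ∧ ⋯ ∧ [D_{k−1}]`
  and the wedge monomials of hypersurface classes are `0` or classes `[Z]` of (reduced) closed analytic subsets.

## References

* [Lange2023AbelianVarietiesComplex] H. Lange, *Abelian Varieties over the Complex Numbers*, Springer 2023,
  §2.1.1 Prop. 2.1.6, §4.6.2 (Lemma 4.6.4, p. 235, proof of Lemma 4.6.9).
* [Fulton1998] W. Fulton, *Intersection Theory*, 2nd ed., Springer 1998, §8.2, Example 11.4.5, §12.2,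
  Appendix B.9.2.
* [Kleiman1974Transversality] S. L. Kleiman, *The transversality of a general translate*, Compositio Math. 28
  (1974) 287–297, Thm. 2.
* [deJong1993AmpleLineBundles] (as cited in `ComplexTorusAnalyticCycleDegreePositive`), Ch. VII §4 Thm. 4.3.1.
-/

noncomputable section

open scoped Manifold Topology Pointwise
open MeasureTheory Set Function Filter Module
open Literature.LinearAlgebra.Alternating

namespace Literature.Geometry.Kaehler
namespace ComplexTorus

universe u

variable {ι : Type*} [Fintype ι] [DecidableEq ι] {E : Type u} [NormedAddCommGroup E] [InnerProductSpace ℂ E]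
  [FiniteDimensional ℂ E] [MeasurableSpace E] [BorelSpace E] (Φ : (ι → ℝ) ≃L[ℝ] E) {n : ℕ} (e : Fin n ≃ ι)

/-! ### §1 A reduced theta divisor: a hypersurface whose class is a polarisation -/

/-- **An abelian variety carries a hypersurface `Θ` with `[Θ]_e = c₁(L) = ofRealForm(−η)` for a polarisation
(Riemann form) `η`**: a reduced member of `|L(η, χ)|` (Prop. 2.1.6), whose divisor is the reduced cycle of its
support, of class `c₁(L)` (Lelong–Poincaré). [cite: Lange2023AbelianVarietiesComplex, §2.1.1 Prop. 2.1.6 (pp. 78–79) and §2.1.2 (p. 79)]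
[cite: VoisinHodgeI2002, §11.3.1 Thm. 11.33] -/
theorem IsAbelianVariety.exists_hasPureDim_analyticCycleClass_eq_ofRealForm (hX : IsAbelianVariety Φ)
    (he : orientationSign Φ e = 1) {q : ℕ} (hq : 2 * q + 2 * 1 = n) :
    ∃ (η : E [⋀^Fin 2]→L[ℝ] ℝ) (Θ : Set (ComplexTorus Φ)) (hΘ : HasPureDim 𝓘(ℂ, E) Θ q),
      IsRiemannForm Φ η ∧ analyticCycleClass Φ e hq hΘ = ofRealForm (-η) := by
  obtain ⟨η, hη⟩ := hX
  have hηNS : IsNSForm Φ η := hη.isNSForm Φ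
  obtain ⟨χ, hχ⟩ := hηNS.exists_isSemicharacter
  have hne : ∃ ϑ ∈ thetaFunctions Φ (canonicalFactor Φ η χ), ϑ ≠ 0 := by
    obtain ⟨ϑ, hϑ, v, hv⟩ := hη.exists_mem_thetaFunctions_ne_zero Φ hχ
    exact ⟨ϑ, hϑ, Function.ne_iff.2 ⟨v, hv⟩⟩
  have hq2 : 2 * q + 2 = n := by omega
  obtain ⟨θ, hθ, hθ0, D, hD, hzero, hmin⟩ := exists_thetaFunction_reduced_divisor Φ e hq2 hηNS hχ hne
  -- `θ` has a zero (`dim X ≥ 1`), so `D ≠ ∅`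
  have hn0 : 0 < n := by omega
  have ht : Φ (Pi.single (e ⟨0, hn0⟩) 1) ≠ 0 := fun h0 ↦ by
    have h1 := Φ.injective (h0.trans (map_zero Φ).symm)
    have h2 := congrFun h1 (e ⟨0, hn0⟩)
    simp at h2
  obtain ⟨v, hv⟩ := hη.exists_apply_eq_zero hχ hθ ht
  rcases hD with hD0 | hD
  · exfalso
    have : v ∈ cover Φ ⁻¹' D := by rw [← hzero]; exact hv
    rw [hD0, preimage_empty] at this
    exact this
  refine ⟨η, D, hD, hη, ?_⟩
  have hdiv := divisorChain_eq_ofSet_of_isMinimalDefiningOn Φ q e hq2 hηNS hχ hθ hθ0 hD hzero.symm hmin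
  have hcl := chainCycleClass_divisorChain Φ e hq2 he hηNS hχ hθ hθ0
  rw [hdiv, chainCycleClass_ofSet] at hcl
  exact hcl

/-- **… hence a hypersurface `Θ` which is NUMERICALLY POSITIVE in every dimension: `[W]_e ∧ [Θ]_e^{∧r} ≠ 0` for
every closed analytic `W ⊆ X` of pure dimension `r`** (`∫_W c₁(L)^r > 0`, [deJong1993AmpleLineBundles, VII
Thm. 4.3.1]; `IsRiemannForm.poincarePairing_wedgePow_analyticCycleClass_ne_zero`).
[cite: Lange2023AbelianVarietiesComplex, §2.1.1 Prop. 2.1.6 and §4.1] [cite: deJong1993AmpleLineBundles, Ch. VII §4 Thm. 4.3.1] -/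
theorem IsAbelianVariety.exists_hasPureDim_forall_wedge_wedgePow_ne_zero (hX : IsAbelianVariety Φ)
    (he : orientationSign Φ e = 1) {q : ℕ} (hq : 2 * q + 2 * 1 = n) :
    ∃ (Θ : Set (ComplexTorus Φ)) (hΘ : HasPureDim 𝓘(ℂ, E) Θ q),
      ∀ {r k' : ℕ} (h : 2 * r + k' = n) {W : Set (ComplexTorus Φ)} (hW : HasPureDim 𝓘(ℂ, E) W r),
        (analyticCycleClass Φ e h hW).wedge (wedgePow (analyticCycleClass Φ e hq hΘ) r) ≠ 0 := by
  obtain ⟨η, Θ, hΘ, hη, hcl⟩ := hX.exists_hasPureDim_analyticCycleClass_eq_ofRealForm Φ e he hq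
  refine ⟨Θ, hΘ, fun {r k'} h {W} hW h0 ↦ ?_⟩
  have hpair := hη.poincarePairing_wedgePow_analyticCycleClass_ne_zero Φ e h hW
  rw [← hcl, poincarePairing_apply] at hpair
  rw [wedge_comm_of_even_left (wedgePow (analyticCycleClass Φ e hq hΘ) r) (analyticCycleClass Φ e h hW),
    domDomCongr_finCongr_eq_zero_iff] at h0
  rw [h0] at hpair
  exact hpair rfl

/-- **… in the orientation-free, geometric form: an abelian variety carries a hypersurface `Θ` such that
EVERY `r` translates of `Θ` meet every closed analytic `W` of pure dimension `r`** (all `r`;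
`wedge_wedgeFamily_ne_zero_iff_forall_inter_iInter_translate_nonempty` at a positively oriented basis).
(The real basis `e : Fin n ≃ ι` only fixes `n = rk Λ`.)
[cite: Lange2023AbelianVarietiesComplex, §2.1.1 Prop. 2.1.6, §4.1 and §4.6.2 Lemma 4.6.4] [cite: deJong1993AmpleLineBundles, Ch. VII §4 Thm. 4.3.1] -/
theorem IsAbelianVariety.exists_hasPureDim_forall_inter_iInter_translate_nonempty (hX : IsAbelianVariety Φ)
    (e : Fin n ≃ ι)
    {q : ℕ} (hq : 2 * q + 2 * 1 = n) :
    ∃ (Θ : Set (ComplexTorus Φ)) (_ : HasPureDim 𝓘(ℂ, E) Θ q),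
      ∀ {r : ℕ} {W : Set (ComplexTorus Φ)}, HasPureDim 𝓘(ℂ, E) W r →
        ∀ s : Fin r → ComplexTorus Φ, (W ∩ ⋂ i, (fun x ↦ x + s i) ⁻¹' Θ).Nonempty := by
  obtain ⟨e₁, he₁⟩ := exists_orientationSign_eq_one Φ e
  obtain ⟨Θ, hΘ, hpos⟩ := hX.exists_hasPureDim_forall_wedge_wedgePow_ne_zero Φ e₁ he₁ hq
  refine ⟨Θ, hΘ, fun {r W} hW s ↦ ?_⟩
  have hng : finrank ℂ E * 2 = n := finrank_complex_mul_two Φ e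
  have hr := hW.le_finrank
  have h : 2 * r + 2 * (finrank ℂ E - r) = n := by omega
  exact (wedge_wedgeFamily_ne_zero_iff_forall_inter_iInter_translate_nonempty Φ e₁ hq r h hW (D := fun _ ↦ Θ)
    fun _ ↦ hΘ).1 (hpos h hW) s

/-! ### §2 Multiplicity one of general iterated hypersurface translates on an abelian variety -/

/-- **ON AN ABELIAN VARIETY, `sign(e)^k · [Y]_e ∧ [D₀]_e ∧ ⋯ ∧ [D_{k−1}]_e = [Y ∩ ⋂_j (D_j − τ_j)]_e` FOR ALMOST
EVERY `τ ∈ X^k`** (any real basis `e`; `Y` closed analytic of pure dimension `r + k`, `D_j` closed analytic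
hypersurfaces): `ComplexTorusAnalyticIteratedTranslatesClass.ae_smul_wedge_wedgeFamily_eq_setCycleClass` with the
numerically positive hypersurface of §1. [cite: Lange2023AbelianVarietiesComplex, §4.6.2 Lemma 4.6.4 and p. 235; proof of Lemma 4.6.9]
[cite: Fulton1998, §8.2, Example 11.4.5 and Appendix B.9.2] [cite: Kleiman1974Transversality, Thm. 2] -/
theorem IsAbelianVariety.ae_smul_wedge_wedgeFamily_eq_setCycleClass (hX : IsAbelianVariety Φ) {q : ℕ}
    (hq : 2 * q + 2 * 1 = n) (k : ℕ) {d p p' r : ℕ} (hk : 2 * d + 2 * p = n) (hp' : p + k = p') (hr : r + k = d)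
    {Y : Set (ComplexTorus Φ)} (hY : HasPureDim 𝓘(ℂ, E) Y d)
    {D : Fin k → Set (ComplexTorus Φ)} (hD : ∀ j, HasPureDim 𝓘(ℂ, E) (D j) q) :
    ∀ᵐ τ ∂(volume : Measure (Fin k → ComplexTorus Φ)),
      (Y ∩ ⋂ j, (fun x ↦ x + τ j) ⁻¹' D j = ∅ ∨ HasPureDim 𝓘(ℂ, E) (Y ∩ ⋂ j, (fun x ↦ x + τ j) ⁻¹' D j) r) ∧
        (orientationSign Φ e : ℂ) ^ k •
            ((analyticCycleClass Φ e hk hY).wedge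
                (wedgeFamily k fun j ↦ analyticCycleClass Φ e hq (hD j))).domDomCongr
              (finCongr (by omega : 2 * p + 2 * k = 2 * p')) =
          setCycleClass Φ e (by omega : 2 * r + 2 * p' = n) (Y ∩ ⋂ j, (fun x ↦ x + τ j) ⁻¹' D j) := by
  obtain ⟨Θ, hΘ, hpos⟩ := hX.exists_hasPureDim_forall_inter_iInter_translate_nonempty Φ e hq
  exact ComplexTorus.ae_smul_wedge_wedgeFamily_eq_setCycleClass Φ e hq k hk hp' hr hY hD hΘ fun W _ _ hW ↦ hpos hW

/-- **ON AN ABELIAN VARIETY, THE INTERSECTION CLASS IS THE CLASS OF A GENERAL ITERATED TRANSLATE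
INTERSECTION.** Let `X` be an abelian variety (a complex torus with a Riemann form), `e` positively oriented,
`Y ⊆ X` closed analytic of pure dimension `r + k` (codimension `p`), `D₀, …, D_{k−1} ⊆ X` closed analytic
hypersurfaces. Then for almost every `τ = (t_j) ∈ X^k` (product Haar measure), `Y ∩ ⋂_j (D_j − t_j)` is
empty or of pure dimension `r`, and `[Y]_e ∧ [D₀]_e ∧ ⋯ ∧ [D_{k−1}]_e = [Y ∩ ⋂_j (D_j − t_j)]_e` in
`H^{2(p+k)}(X, ℂ)` — general translates meet with ALL MULTIPLICITIES ONE ("`(V · W)` is the degree of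
`V · t_x^* W`"; "the cycles `φ_g(V) · W` … represent `V · W`"; Kleiman (b)): `ComplexTorusAnalyticIteratedTranslatesClass`
with the numerically positive hypersurface of §1. [cite: Lange2023AbelianVarietiesComplex, §4.6.2 Lemma 4.6.4 and p. 235; proof of Lemma 4.6.9]
[cite: Fulton1998, §8.2, Example 11.4.5 and Appendix B.9.2] [cite: Kleiman1974Transversality, Thm. 2] -/
theorem IsAbelianVariety.ae_wedge_wedgeFamily_eq_setCycleClass (hX : IsAbelianVariety Φ)
    (he : orientationSign Φ e = 1) {q : ℕ} (hq : 2 * q + 2 * 1 = n)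
    (k : ℕ) {d p p' r : ℕ} (hk : 2 * d + 2 * p = n) (hp' : p + k = p') (hr : r + k = d)
    {Y : Set (ComplexTorus Φ)} (hY : HasPureDim 𝓘(ℂ, E) Y d)
    {D : Fin k → Set (ComplexTorus Φ)} (hD : ∀ j, HasPureDim 𝓘(ℂ, E) (D j) q) :
    ∀ᵐ τ ∂(volume : Measure (Fin k → ComplexTorus Φ)),
      (Y ∩ ⋂ j, (fun x ↦ x + τ j) ⁻¹' D j = ∅ ∨ HasPureDim 𝓘(ℂ, E) (Y ∩ ⋂ j, (fun x ↦ x + τ j) ⁻¹' D j) r) ∧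
        ((analyticCycleClass Φ e hk hY).wedge
              (wedgeFamily k fun j ↦ analyticCycleClass Φ e hq (hD j))).domDomCongr
            (finCongr (by omega : 2 * p + 2 * k = 2 * p')) =
          setCycleClass Φ e (by omega : 2 * r + 2 * p' = n) (Y ∩ ⋂ j, (fun x ↦ x + τ j) ⁻¹' D j) := by
  filter_upwards [hX.ae_smul_wedge_wedgeFamily_eq_setCycleClass Φ e hq k hk hp' hr hY hD] with τ ⟨h₁, h₂⟩
  refine ⟨h₁, ?_⟩
  rwa [he, Int.cast_one, one_pow, one_smul] at h₂

/-- **Some (indeed almost every) iterated translate realises `[Y] ∧ [D₀] ∧ ⋯ ∧ [D_{k−1}]` as the class of the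
set-theoretic intersection**, on an abelian variety. [cite: Lange2023AbelianVarietiesComplex, §4.6.2 Lemma 4.6.4 and p. 235]
[cite: Fulton1998, Example 11.4.5] -/
theorem IsAbelianVariety.exists_wedge_wedgeFamily_eq_setCycleClass (hX : IsAbelianVariety Φ)
    (he : orientationSign Φ e = 1) {q : ℕ} (hq : 2 * q + 2 * 1 = n)
    (k : ℕ) {d p p' r : ℕ} (hk : 2 * d + 2 * p = n) (hp' : p + k = p') (hr : r + k = d)
    {Y : Set (ComplexTorus Φ)} (hY : HasPureDim 𝓘(ℂ, E) Y d)
    {D : Fin k → Set (ComplexTorus Φ)} (hD : ∀ j, HasPureDim 𝓘(ℂ, E) (D j) q) :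
    ∃ τ : Fin k → ComplexTorus Φ,
      (Y ∩ ⋂ j, (fun x ↦ x + τ j) ⁻¹' D j = ∅ ∨ HasPureDim 𝓘(ℂ, E) (Y ∩ ⋂ j, (fun x ↦ x + τ j) ⁻¹' D j) r) ∧
        ((analyticCycleClass Φ e hk hY).wedge
              (wedgeFamily k fun j ↦ analyticCycleClass Φ e hq (hD j))).domDomCongr
            (finCongr (by omega : 2 * p + 2 * k = 2 * p')) =
          setCycleClass Φ e (by omega : 2 * r + 2 * p' = n) (Y ∩ ⋂ j, (fun x ↦ x + τ j) ⁻¹' D j) :=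
  (hX.ae_wedge_wedgeFamily_eq_setCycleClass Φ e he hq k hk hp' hr hY hD).exists

/-! ### §3 Hypersurfaces only: `[D₀] ∧ ⋯ ∧ [D_{k−1}] = [⋂_j (D_j − τ_j)]` for almost every `τ` -/

/-- **ON AN ABELIAN VARIETY, `[D₀]_e ∧ ⋯ ∧ [D_{k−1}]_e = [(D₀ − t₀) ∩ ⋯ ∩ (D_{k−1} − t_{k−1})]_e` FOR ALMOST EVERY
`(t_j) ∈ X^k`** (`e` positively oriented; `D_j` closed analytic hypersurfaces, `k ≤ dim X`; the intersection is
empty or of pure dimension `dim X − k`): the wedge monomials of hypersurface classes — in particular the powers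
`c₁(L)^{∧k}` of a polarisation, `L = 𝒪(Θ)` — are the classes of REDUCED complete intersections of general
translates ([Lange2023AbelianVarietiesComplex, §4.6.2 and §7.3.1: "complete intersections of `p` general
translates of a theta divisor represent `c₁(L)^p`"]; §2 with `Y = X`, `[X]_e = 1`).
[cite: Lange2023AbelianVarietiesComplex, §4.6.2 Lemma 4.6.4 and p. 235; §7.3.1 (p. 336)] [cite: Fulton1998, Example 11.4.5] -/
theorem IsAbelianVariety.ae_wedgeFamily_eq_setCycleClass_iInter_translate (hX : IsAbelianVariety Φ)
    (he : orientationSign Φ e = 1) {q : ℕ} (hq : 2 * q + 2 * 1 = n) (k : ℕ) {r : ℕ} (hr : r + k = finrank ℂ E)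
    {D : Fin k → Set (ComplexTorus Φ)} (hD : ∀ j, HasPureDim 𝓘(ℂ, E) (D j) q) :
    ∀ᵐ τ ∂(volume : Measure (Fin k → ComplexTorus Φ)),
      (⋂ j, (fun x ↦ x + τ j) ⁻¹' D j = ∅ ∨ HasPureDim 𝓘(ℂ, E) (⋂ j, (fun x ↦ x + τ j) ⁻¹' D j) r) ∧
        wedgeFamily k (fun j ↦ analyticCycleClass Φ e hq (hD j)) =
          setCycleClass Φ e (by have := finrank_complex_mul_two Φ e; omega : 2 * r + 2 * k = n)
            (⋂ j, (fun x ↦ x + τ j) ⁻¹' D j) := by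
  have hng : finrank ℂ E * 2 = n := finrank_complex_mul_two Φ e
  have hk : 2 * finrank ℂ E + 2 * 0 = n := by omega
  filter_upwards [hX.ae_wedge_wedgeFamily_eq_setCycleClass Φ e he hq k hk (p' := k) (by omega) hr
    (hasPureDim_univ (I := 𝓘(ℂ, E)) (M := ComplexTorus Φ)) hD] with τ ⟨h₁, h₂⟩
  rw [univ_inter] at h₁ h₂
  refine ⟨h₁, ?_⟩
  rw [← h₂, analyticCycleClass_univ, he, Int.cast_one, one_smul, constOfIsEmpty_wedge_eq_smul, one_smul,
    domDomCongr_finCongr_trans, domDomCongr_finCongr_self]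

/-! ### §4 The powers of a polarisation are classes of reduced analytic subsets -/

/-- `setCycleClass ∅ = 0`. [folklore] -/
private theorem setCycleClass_empty₆ {k d : ℕ} (h : 2 * d + k = n) :
    setCycleClass Φ e h (∅ : Set (ComplexTorus Φ)) = 0 := by
  have hne : ¬ HasPureDim 𝓘(ℂ, E) (∅ : Set (ComplexTorus Φ)) d := fun h' ↦ by
    simpa using HasPureDim.nonempty h'
  rw [setCycleClass, dif_neg hne]

/-- **Every power `c₁(L)^{∧k}` (`k ≤ dim X`) of a polarisation of an abelian variety is the class of a REDUCED
closed analytic subset of pure dimension `dim X − k`** — a general complete intersection of `k` translates of a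
reduced theta divisor `Θ ∈ |L|` (§3), non-empty because `c₁(L)^{∧k} ≠ 0`
(`IsRiemannForm.wedgePow_ofRealForm_ne_zero`). Lange: "complete intersections of `p` general translates of a
theta divisor represent `c₁(L)^p`" — here with all multiplicities one; `e` positively oriented.
[cite: Lange2023AbelianVarietiesComplex, §7.3.1 (p. 336) and §4.6.2 Lemma 4.6.4] [cite: VoisinHodgeI2002, §11.3.1 (p. 280)] -/
theorem IsAbelianVariety.exists_forall_hasPureDim_analyticCycleClass_eq_wedgePow (hX : IsAbelianVariety Φ)
    (he : orientationSign Φ e = 1) :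
    ∃ η : E [⋀^Fin 2]→L[ℝ] ℝ, IsRiemannForm Φ η ∧ ∀ (k : ℕ) {r : ℕ} (hr : r + k = finrank ℂ E),
      ∃ (Z : Set (ComplexTorus Φ)) (hZ : HasPureDim 𝓘(ℂ, E) Z r),
        analyticCycleClass Φ e (by have := finrank_complex_mul_two Φ e; omega : 2 * r + 2 * k = n) hZ =
          wedgePow (ofRealForm (-η)) k := by
  have hng : finrank ℂ E * 2 = n := finrank_complex_mul_two Φ e
  -- `k = 0`: the whole torus, `[X]_e = 1`
  have huniv : ∀ (η : E [⋀^Fin 2]→L[ℝ] ℝ) {r : ℕ} (hr : r + 0 = finrank ℂ E),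
      ∃ (Z : Set (ComplexTorus Φ)) (hZ : HasPureDim 𝓘(ℂ, E) Z r),
        analyticCycleClass Φ e (by omega : 2 * r + 2 * 0 = n) hZ = wedgePow (ofRealForm (-η)) 0 := by
    intro η r hr
    have hr' : r = finrank ℂ E := by omega
    subst hr'
    exact ⟨univ, hasPureDim_univ, by
      rw [wedgePow_zero]; exact analyticCycleClass_univ_of_orientationSign_eq_one Φ e _ he⟩
  rcases Nat.eq_zero_or_pos (finrank ℂ E) with hg | hg
  · obtain ⟨η, hη⟩ := hX
    refine ⟨η, hη, fun k r hr ↦ ?_⟩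
    have hk : k = 0 := by omega
    subst hk
    exact huniv η hr
  · have hq : 2 * (finrank ℂ E - 1) + 2 * 1 = n := by omega
    obtain ⟨η, Θ, hΘ, hη, hcl⟩ := hX.exists_hasPureDim_analyticCycleClass_eq_ofRealForm Φ e he hq
    have hnd : ∀ u : E, (∀ v : E, (-η) ![u, v] = 0) → u = 0 := fun u hu ↦
      hη.nondegenerate' u fun v ↦ by simpa using hu v
    refine ⟨η, hη, fun k r hr ↦ ?_⟩
    rcases Nat.eq_zero_or_pos k with hk | hk
    · subst hk
      exact huniv η hr
    · obtain ⟨τ, hZ, hcls⟩ :=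
        (hX.ae_wedgeFamily_eq_setCycleClass_iInter_translate Φ e he hq k hr (D := fun _ ↦ Θ) fun _ ↦ hΘ).exists
      have hw : wedgeFamily k (fun _ : Fin k ↦ analyticCycleClass Φ e hq hΘ) = wedgePow (ofRealForm (-η)) k := by
        rw [hcl]
        rfl
      rw [hw] at hcls
      rcases hZ with hZ0 | hZr
      · exfalso
        rw [hZ0, setCycleClass_empty₆] at hcls
        exact wedgePow_ofRealForm_ne_zero (-η) hnd (by omega : k ≤ finrank ℂ E) hcls
      · exact ⟨_, hZr, by rw [← setCycleClass_of_hasPureDim Φ e _ hZr, ← hcls]⟩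

/-! ### §5 Products with hypersurface classes are classes of reduced analytic subsets (or zero) -/

/-- **On an abelian variety, `[Y]_e ∧ [D₀]_e ∧ ⋯ ∧ [D_{k−1}]_e` is `0` or the class `[Z]_e` of a closed analytic
`Z ⊆ Y` of pure dimension `dim Y − k`** (namely a general `Y ∩ ⋂_j (D_j − τ_j)`, §2; `e` positively oriented):
products of the class of an analytic subset with hypersurface classes stay inside the set of classes of
(reduced) analytic subsets. [cite: Lange2023AbelianVarietiesComplex, §4.6.2 Lemma 4.6.4 and p. 235; §7.3.1 (p. 336)]
[cite: Fulton1998, Example 11.4.5] -/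
theorem IsAbelianVariety.wedge_wedgeFamily_eq_zero_or_exists_eq_analyticCycleClass (hX : IsAbelianVariety Φ)
    (he : orientationSign Φ e = 1) {q : ℕ} (hq : 2 * q + 2 * 1 = n)
    (k : ℕ) {d p p' r : ℕ} (hk : 2 * d + 2 * p = n) (hp' : p + k = p') (hr : r + k = d)
    {Y : Set (ComplexTorus Φ)} (hY : HasPureDim 𝓘(ℂ, E) Y d)
    {D : Fin k → Set (ComplexTorus Φ)} (hD : ∀ j, HasPureDim 𝓘(ℂ, E) (D j) q) :
    ((analyticCycleClass Φ e hk hY).wedge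
          (wedgeFamily k fun j ↦ analyticCycleClass Φ e hq (hD j))).domDomCongr
        (finCongr (by omega : 2 * p + 2 * k = 2 * p')) = 0 ∨
      ∃ (Z : Set (ComplexTorus Φ)) (hZ : HasPureDim 𝓘(ℂ, E) Z r), Z ⊆ Y ∧
        ((analyticCycleClass Φ e hk hY).wedge
              (wedgeFamily k fun j ↦ analyticCycleClass Φ e hq (hD j))).domDomCongr
            (finCongr (by omega : 2 * p + 2 * k = 2 * p')) =
          analyticCycleClass Φ e (by omega : 2 * r + 2 * p' = n) hZ := by
  obtain ⟨τ, hZ, hcl⟩ := (hX.ae_wedge_wedgeFamily_eq_setCycleClass Φ e he hq k hk hp' hr hY hD).exists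
  rcases hZ with hZ0 | hZr
  · left
    rw [hcl, hZ0, setCycleClass_empty₆]
  · right
    exact ⟨_, hZr, inter_subset_left, by rw [hcl, setCycleClass_of_hasPureDim Φ e _ hZr]⟩

/-- **On an abelian variety, every wedge monomial `[D₀]_e ∧ ⋯ ∧ [D_{k−1}]_e` of hypersurface classes (`k ≤ dim X`)
is `0` or the class `[Z]_e` of a closed analytic `Z` of pure dimension `dim X − k`** (a general
`⋂_j (D_j − τ_j)`, §3): the monomials spanning Lange's divisorial ring `D•(X)` are themselves classes of reduced
analytic subsets. [cite: Lange2023AbelianVarietiesComplex, §7.3.1 (p. 336) and §4.6.2] [cite: Fulton1998, Example 11.4.5] -/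
theorem IsAbelianVariety.wedgeFamily_eq_zero_or_exists_eq_analyticCycleClass (hX : IsAbelianVariety Φ)
    (he : orientationSign Φ e = 1) {q : ℕ} (hq : 2 * q + 2 * 1 = n) (k : ℕ) {r : ℕ} (hr : r + k = finrank ℂ E)
    {D : Fin k → Set (ComplexTorus Φ)} (hD : ∀ j, HasPureDim 𝓘(ℂ, E) (D j) q) :
    wedgeFamily k (fun j ↦ analyticCycleClass Φ e hq (hD j)) = 0 ∨
      ∃ (Z : Set (ComplexTorus Φ)) (hZ : HasPureDim 𝓘(ℂ, E) Z r),
        wedgeFamily k (fun j ↦ analyticCycleClass Φ e hq (hD j)) =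
          analyticCycleClass Φ e (by have := finrank_complex_mul_two Φ e; omega : 2 * r + 2 * k = n) hZ := by
  obtain ⟨τ, hZ, hcl⟩ := (hX.ae_wedgeFamily_eq_setCycleClass_iInter_translate Φ e he hq k hr hD).exists
  rcases hZ with hZ0 | hZr
  · left
    rw [hcl, hZ0, setCycleClass_empty₆]
  · right
    exact ⟨_, hZr, by rw [hcl, setCycleClass_of_hasPureDim Φ e _ hZr]⟩

end ComplexTorus
end Literature.Geometry.Kaehler

end
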